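import Literature.MathematicalPhysics.QuantumFieldTheory.Balaban1983to89.B9Eq325RLipschitzResolvent

/-!
# `Balaban1983to89.B9Eq364GreenLipschitzForm` — T. Bałaban, *Propagators for lattice gauge theories in a background field*, Commun. Math. Phys.
# **99** (1985) 389–434 [Balaban1985BackgroundPropagators] (3.63)–(3.64) p. 402: **`G′(U)` AGAINST `G′(1)` BY THE FORM-RELATIVE (KATO) RESOLVENT
# STEP — `‖G′₂y − G′₁y‖ ≤ (2δγ^{−3∕2} + δ′γ^{−2})·‖y‖` FROM A FORM-BOUNDED DIFFERENCE `Δ′₁ − Δ′₂`, NO OPERATOR NORM OF `Δ′₁ − Δ′₂`**; at the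
# pub-balaban NE9 chain's `Δ′_a(U)` the letter `θ_G` of `B9Eq325RLipschitzResolvent.norm_RofU_sub_RofU_le` PRODUCED modulo the displayed coercivity `γ`

statement-level skeleton of published theorems with citation tags; proofs where landed; nothing here is a claim about the Yang–Mills mass gap

CITATION HEADER (lean-in-tree rule).  Audit cell `pub-balaban`, sub-cell `t4`, BINDER row NE9; filed by NE9 formalisation-swarm leaf prover 06
(`b2b-balaban-t4-ne9-formalise-leaf-06`, gen 63) as sub-step S3d-2 of route R2′ STEP B7′ (`t4/ROUTES-NE9.md` v13.19 l.407; NE9 leaf-03's S3b files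
`B9Thm311SitePrimeFormCoercive(Canonical)` supply the strong∕weak coercivity `γ`, this file the `G′`-difference they defer «to S3d»).  Source READ in the
held text: [Balaban1985BackgroundPropagators] pp. 402–403 (`paper:balaban1985-cmp99-background-propagators`, journal page = PDF page + 388).

THE PRINT (verbatim, p. 402).  *«Δ′_a(U′U) = Δ′_a(U) − V′(A) = (I − V′(A)G′(U))Δ′_a(U), (3.63) hence G′(U′U) = G′(U)(I − V′(A)G′(U))⁻¹ (3.64)»*;
p. 403: *«These results imply that the operators R(U), P(U) = I − R(U) extend analytically to the domain (3.37) and satisfy the same bounds.»*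

WHY.  `B9Eq386ResolventLetters.norm_greenK_sub_greenK_le` is the resolvent step with an OPERATOR-norm difference `‖Δ′₂x − Δ′₁x‖ ≤ δ‖x‖` — at the chain's
letters `δ` carries `‖η⁻¹‖` per derivative (route R2′ STEP B7′ (i)(a)).  Here the difference is measured as a FORM against the energies
`re⟪·, Δ′_i ·⟫`: `|⟪z, Δ′₁w⟫ − ⟪z, Δ′₂w⟫| ≤ δ·(‖z‖·√re⟪w,Δ′₁w⟫ + √re⟪z,Δ′₂z⟫·‖w‖) + δ′·‖z‖·‖w‖` — for `Δ′_a = D*D + a′Q̃′†Q̃′` this holds with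
`δ = ‖D₂ − D₁‖` (one `η⁻¹` times `εR = K_Rαη`: η-free) and `δ′ = a′θ_Q(M_Q(1) + M_Q(2))` — and the resolvent identity `G′₂ − G′₁ = G′₂(Δ′₁ − Δ′₂)G′₁`
is read as that form at `z = G′₂x`, `w = G′₁y`, the energy factors fed by `re⟪G′_iy, y⟫ ≤ γ⁻¹‖y‖²`.

WHAT IS PROVED (sorry-free; proof lane — no `def`, no `Prop` placeholder, nothing of [B9] asserted hypothesis-free).
* §1 (abstract, `RCLike 𝕜`, finite-dimensional `E`): `re_inner_greenK_le` (`re⟪G y, y⟫ ≤ γ⁻¹‖y‖²`), `energy_greenK_le` (`re⟪G y, T(G y)⟫ ≤ γ⁻¹‖y‖²`),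
  **`norm_greenK_sub_greenK_le_of_form`** (`‖G₂y − G₁y‖ ≤ (2δγ^{−3∕2} + δ′γ^{−2})·‖y‖`, with `γ^{−3∕2}` written `γ⁻¹·(√γ)⁻¹`).
* §2 (the chain, two backgrounds `U₁`, `U₂` with letters `hRS_i`, `hpos′_i`): `inner_laplacePrimeA_eq` (the sesquilinear (3.24):
  `⟪z, Δ′_a(U)w⟫ = ⟪D_Uz, D_Uw⟫ + a′⟪Q̃′(U)z, Q̃′(U)w⟫`), `norm_covDerivL2K_le_sqrt_re_inner` (`‖D_Uw‖ ≤ √re⟪w, Δ′_a(U)w⟫`),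
  **`norm_GpOfU_sub_GpOfU_le`** — `‖G′(U₁)y − G′(U₂)y‖ ≤ (2δ_Dγ⁻¹(√γ)⁻¹ + |a′|θ_Q(M₁ + M₂)γ⁻²)·‖y‖` (the `hdG` slot's order) from the DISPLAYED letters `γ` (coercivity of both
  `Δ′_a(U_i)`), `δ_D` (`‖D_{U₂}x − D_{U₁}x‖ ≤ δ_D‖x‖`), `M_i` (`‖Q̃′(U_i)‖`), `θ_Q` (`‖Q̃′(U₂) − Q̃′(U₁)‖`) — the `θ_G` slot of
  `B9Eq325RLipschitzResolvent.norm_RofU_sub_RofU_le`.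
HONEST SCOPE.  [folklore] Kato-type resolvent bookkeeping at the chain's letters; `γ` stays displayed (NE9 leaf-03's S3b), `δ_D`, `M_i`, `θ_Q` are the
chain's one-step letters (η-free-shaped under `c₁(ηL)² = c₀L^d` by `B9Eq373DerivativeRemainderL2.norm_covDerivL2K_sub_le` and `B9Eq325RLipschitzResolvent`
§4 — the η-freeness is the route's reading, not asserted here); ONE sub-step of a route step, NOT NE9 (cell pub-balaban: NE9 NOT PRINTED ∕ NOT PROVED;
spine PROVED 0∕9; rung (B)+1 on a finite T⁴ — NOT infinite volume, NOT mass gap, NOT Clay).  NEW file; nothing modified.  Net new unproved facts: 0.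
-/

noncomputable section

open scoped InnerProductSpace ComplexConjugate BigOperators

namespace Literature.MathematicalPhysics.QuantumFieldTheory.Balaban1983to89.B9Eq364GreenLipschitzForm

open B4Sect5Torus (TSite)
open B9SectCLatticeCarrier (Bond)
open B9Eq311L2Pairing (WL2)
open B9Eq319QprimeTorus (fineP)
open B11Eq103H1Complex (SiteL2K greenK apply_greenK greenK_apply covLaplaceSiteK covDerivL2K adjoint_covDerivL2K)
open B9Eq310HessianOperator (adTransportW)
open B9Eq326OperatorAssembly (QprimeW)
open B9Eq3119DeltaPiCarrier (laplacePrimeA GpOfU)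
open B9Eq3126GreenLetters (norm_greenK_le)
open B9Eq325ProjFormula (laplacePrimeA_isSymmetric)

/-! ## §1 The form-relative resolvent step -/

section Abstract

variable {𝕜 : Type*} [RCLike 𝕜] {E : Type*} [NormedAddCommGroup E] [InnerProductSpace 𝕜 E] [FiniteDimensional 𝕜 E]
  {T : E →ₗ[𝕜] E} {γ : ℝ} (hγ : 0 < γ) (hcoer : ∀ x : E, γ * ‖x‖ ^ 2 ≤ RCLike.re ⟪x, T x⟫_𝕜)
  (hpos : ∀ x : E, x ≠ 0 → 0 < RCLike.re ⟪x, T x⟫_𝕜)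

include hγ hcoer in
/-- `re⟪G y, y⟫ ≤ γ⁻¹‖y‖²` for the inverse `G` of a `γ`-coercive `T` (`‖Gy‖ ≤ γ⁻¹‖y‖`, Cauchy–Schwarz). [cite: Balaban1985BackgroundPropagators, Thm 3.11 p.416, (3.64) p.402] -/
theorem re_inner_greenK_le (y : E) : RCLike.re ⟪greenK T hpos y, y⟫_𝕜 ≤ γ⁻¹ * ‖y‖ ^ 2 :=
  calc RCLike.re ⟪greenK T hpos y, y⟫_𝕜 ≤ ‖greenK T hpos y‖ * ‖y‖ := re_inner_le_norm _ _
    _ ≤ γ⁻¹ * ‖y‖ * ‖y‖ := mul_le_mul_of_nonneg_right (norm_greenK_le hγ hcoer hpos y) (norm_nonneg _)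
    _ = γ⁻¹ * ‖y‖ ^ 2 := by ring

include hγ hcoer in
/-- THE ENERGY OF `G y`: `re⟪G y, T(G y)⟫ = re⟪G y, y⟫ ≤ γ⁻¹‖y‖²`. [cite: Balaban1985BackgroundPropagators, Thm 3.11 p.416, (3.64) p.402] -/
theorem energy_greenK_le (y : E) : RCLike.re ⟪greenK T hpos y, T (greenK T hpos y)⟫_𝕜 ≤ γ⁻¹ * ‖y‖ ^ 2 := by
  rw [apply_greenK]
  exact re_inner_greenK_le hγ hcoer hpos y

variable {T₁ T₂ : E →ₗ[𝕜] E} (h₁ : ∀ x : E, x ≠ 0 → 0 < RCLike.re ⟪x, T₁ x⟫_𝕜) (h₂ : ∀ x : E, x ≠ 0 → 0 < RCLike.re ⟪x, T₂ x⟫_𝕜)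
  (hc₁ : ∀ x : E, γ * ‖x‖ ^ 2 ≤ RCLike.re ⟪x, T₁ x⟫_𝕜) (hc₂ : ∀ x : E, γ * ‖x‖ ^ 2 ≤ RCLike.re ⟪x, T₂ x⟫_𝕜)
  (hT₂ : T₂.IsSymmetric) {δ δ' : ℝ} (hδ : 0 ≤ δ) (hδ' : 0 ≤ δ')
  (hform : ∀ z w : E, ‖⟪z, T₁ w⟫_𝕜 - ⟪z, T₂ w⟫_𝕜‖ ≤
    δ * (‖z‖ * Real.sqrt (RCLike.re ⟪w, T₁ w⟫_𝕜) + Real.sqrt (RCLike.re ⟪z, T₂ z⟫_𝕜) * ‖w‖) + δ' * (‖z‖ * ‖w‖))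

include hγ hc₁ hc₂ hT₂ hδ hδ' hform in
/-- **THE FORM-RELATIVE RESOLVENT STEP** ((3.63)–(3.64) «G′(U′U) = G′(U)(I − V′(A)G′(U))⁻¹» read in `L²` WITHOUT an operator norm of `V′`): for two
symmetric `γ`-coercive operators whose difference is FORM-bounded —
`|⟪z,T₁w⟫ − ⟪z,T₂w⟫| ≤ δ(‖z‖√re⟪w,T₁w⟫ + √re⟪z,T₂z⟫‖w‖) + δ′‖z‖‖w‖` — the inverses satisfy
`‖G₂y − G₁y‖ ≤ (2δγ⁻¹(√γ)⁻¹ + δ′γ⁻²)·‖y‖`: with `x := G₂y − G₁y = G₂(T₁ − T₂)G₁y`, `‖x‖² = re(⟪G₂x, T₁G₁y⟫ − ⟪G₂x, T₂G₁y⟫)` and the energies of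
`G₂x`, `G₁y` are `≤ γ⁻¹‖x‖²`, `γ⁻¹‖y‖²`. [cite: Balaban1985BackgroundPropagators, (3.63)–(3.64) p.402, p.403] -/
theorem norm_greenK_sub_greenK_le_of_form (y : E) :
    ‖greenK T₂ h₂ y - greenK T₁ h₁ y‖ ≤ (2 * δ * (γ⁻¹ * (Real.sqrt γ)⁻¹) + δ' * γ⁻¹ ^ 2) * ‖y‖ := by
  set x := greenK T₂ h₂ y - greenK T₁ h₁ y with hx
  set z := greenK T₂ h₂ x with hz
  set w := greenK T₁ h₁ y with hw
  have hγ0 : 0 ≤ γ⁻¹ := by positivity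
  have hsγ : 0 < Real.sqrt γ := Real.sqrt_pos.2 hγ
  -- `x = G₂ (T₁ w − T₂ w)` (resolvent identity)
  have hres : x = greenK T₂ h₂ (T₁ w - T₂ w) := by
    rw [map_sub, hw, apply_greenK h₁, greenK_apply h₂]
  -- `‖x‖² = re(⟪z, T₁w⟫ − ⟪z, T₂w⟫)` by the symmetry of `T₂` (`x = G₂v`, `⟪x, G₂v⟫ = ⟪G₂x, v⟫`)
  have hG₂symm : (greenK T₂ h₂).IsSymmetric := fun a b => by
    have h := hT₂ (greenK T₂ h₂ a) (greenK T₂ h₂ b)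
    rw [apply_greenK, apply_greenK] at h
    exact h.symm
  have hsq : ‖x‖ ^ 2 = RCLike.re (⟪z, T₁ w⟫_𝕜 - ⟪z, T₂ w⟫_𝕜) := by
    rw [← inner_sub_right, hz, hG₂symm, ← hres, inner_self_eq_norm_sq]
  -- the letters on `z` and `w`
  have hzn : ‖z‖ ≤ γ⁻¹ * ‖x‖ := norm_greenK_le hγ hc₂ h₂ x
  have hwn : ‖w‖ ≤ γ⁻¹ * ‖y‖ := norm_greenK_le hγ hc₁ h₁ y
  have hEw : Real.sqrt (RCLike.re ⟪w, T₁ w⟫_𝕜) ≤ (Real.sqrt γ)⁻¹ * ‖y‖ := by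
    have h := energy_greenK_le hγ hc₁ h₁ y
    calc Real.sqrt (RCLike.re ⟪w, T₁ w⟫_𝕜) ≤ Real.sqrt (γ⁻¹ * ‖y‖ ^ 2) := Real.sqrt_le_sqrt h
      _ = (Real.sqrt γ)⁻¹ * ‖y‖ := by rw [Real.sqrt_mul hγ0, Real.sqrt_inv, Real.sqrt_sq (norm_nonneg _)]
  have hEz : Real.sqrt (RCLike.re ⟪z, T₂ z⟫_𝕜) ≤ (Real.sqrt γ)⁻¹ * ‖x‖ := by
    have h := energy_greenK_le hγ hc₂ h₂ x
    calc Real.sqrt (RCLike.re ⟪z, T₂ z⟫_𝕜) ≤ Real.sqrt (γ⁻¹ * ‖x‖ ^ 2) := Real.sqrt_le_sqrt h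
      _ = (Real.sqrt γ)⁻¹ * ‖x‖ := by rw [Real.sqrt_mul hγ0, Real.sqrt_inv, Real.sqrt_sq (norm_nonneg _)]
  -- `‖x‖² ≤ C·‖x‖·‖y‖`
  have hmain : ‖x‖ ^ 2 ≤ (2 * δ * (γ⁻¹ * (Real.sqrt γ)⁻¹) + δ' * γ⁻¹ ^ 2) * ‖y‖ * ‖x‖ := by
    calc ‖x‖ ^ 2 = RCLike.re (⟪z, T₁ w⟫_𝕜 - ⟪z, T₂ w⟫_𝕜) := hsq
      _ ≤ ‖⟪z, T₁ w⟫_𝕜 - ⟪z, T₂ w⟫_𝕜‖ := RCLike.re_le_norm _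
      _ ≤ δ * (‖z‖ * Real.sqrt (RCLike.re ⟪w, T₁ w⟫_𝕜) + Real.sqrt (RCLike.re ⟪z, T₂ z⟫_𝕜) * ‖w‖) + δ' * (‖z‖ * ‖w‖) := hform z w
      _ ≤ δ * ((γ⁻¹ * ‖x‖) * ((Real.sqrt γ)⁻¹ * ‖y‖) + ((Real.sqrt γ)⁻¹ * ‖x‖) * (γ⁻¹ * ‖y‖)) + δ' * ((γ⁻¹ * ‖x‖) * (γ⁻¹ * ‖y‖)) := by
          gcongr
      _ = (2 * δ * (γ⁻¹ * (Real.sqrt γ)⁻¹) + δ' * γ⁻¹ ^ 2) * ‖y‖ * ‖x‖ := by ring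
  -- divide by `‖x‖`
  rcases eq_or_lt_of_le (norm_nonneg x) with h0 | hxpos
  · rw [← h0]; positivity
  · exact le_of_mul_le_mul_right (by rw [← pow_two]; linarith [hmain]) hxpos

end Abstract

/-! ## §2 The chain: `G′(U₂)` against `G′(U₁)` from `δ_D`, `θ_Q`, `M_Q` and the displayed coercivity `γ` -/

section Chain

variable {d : ℕ} (L : ℕ) [NeZero L] (m : Fin d → ℕ) {𝔸 : Type*} [Ring 𝔸] [Algebra ℂ 𝔸]
  {W : Type*} [NormedAddCommGroup W] [InnerProductSpace ℂ W] [FiniteDimensional ℂ W] (φ : W ≃ₗ[ℂ] 𝔸) (c₀ : ℝ) [Fact (0 < c₀)]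
  (η : ℝ) (U₁ U₂ : Bond d (fineP L m) → 𝔸ˣ) (c₁ : ℝ) [Fact (0 < c₁)] (a' : ℝ) (ha' : 0 ≤ a')
  (hRS₁ : ∀ (b : Bond d (fineP L m)) (v u : W), ⟪adTransportW φ U₁ b v, u⟫_ℂ = ⟪v, adTransportW φ (fun b => (U₁ b)⁻¹) b u⟫_ℂ)
  (hRS₂ : ∀ (b : Bond d (fineP L m)) (v u : W), ⟪adTransportW φ U₂ b v, u⟫_ℂ = ⟪v, adTransportW φ (fun b => (U₂ b)⁻¹) b u⟫_ℂ)

include hRS₁ in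
/-- **THE SESQUILINEAR (3.24)**: `⟪z, Δ′_a(U)w⟫ = ⟪D_Uz, D_Uw⟫ + a′·⟪Q̃′(U)z, Q̃′(U)w⟫` for mutually adjoint transporters (`D*_U = D_U†`,
`B11Eq103H1Complex.adjoint_covDerivL2K`) — the bilinear companion of `B9Thm311DeltaPrimeA.re_inner_laplacePrimeA`.
[cite: Balaban1985BackgroundPropagators, (3.23)–(3.24) p.394] -/
theorem inner_laplacePrimeA_eq (z w : SiteL2K ℂ d (fineP L m) c₀ W) :
    ⟪z, laplacePrimeA L m φ η U₁ a' (c₁ := c₁) w⟫_ℂ =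
      ⟪covDerivL2K ℂ c₀ ((η : ℂ))⁻¹ (adTransportW φ U₁) z, covDerivL2K ℂ c₀ ((η : ℂ))⁻¹ (adTransportW φ U₁) w⟫_ℂ +
        (a' : ℂ) * ⟪((WL2.linearEquiv ℂ ℂ (fun _ : TSite d m => c₁)).symm.toLinearMap ∘ₗ QprimeW L m φ U₁ (c₀ := c₀)) z,
          ((WL2.linearEquiv ℂ ℂ (fun _ : TSite d m => c₁)).symm.toLinearMap ∘ₗ QprimeW L m φ U₁ (c₀ := c₀)) w⟫_ℂ := by
  have hc : conj (((η : ℂ))⁻¹) = ((η : ℂ))⁻¹ := by rw [map_inv₀, Complex.conj_ofReal]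
  simp only [laplacePrimeA, covLaplaceSiteK, LinearMap.add_apply, LinearMap.smul_apply, LinearMap.comp_apply, inner_add_right, inner_smul_right]
  rw [← adjoint_covDerivL2K _ hc _ _ hRS₁, LinearMap.adjoint_inner_right, LinearMap.adjoint_inner_right]
  simp only [LinearMap.comp_apply]

include hRS₁ ha' in
/-- `‖D_Uw‖ ≤ √re⟪w, Δ′_a(U)w⟫` (`re⟪w, Δ′_a(U)w⟫ = ‖D_Uw‖² + a′‖Q̃′(U)w‖²`, `a′ ≥ 0`). [cite: Balaban1985BackgroundPropagators, (3.24) p.394] -/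
theorem norm_covDerivL2K_le_sqrt_re_inner (w : SiteL2K ℂ d (fineP L m) c₀ W) :
    ‖covDerivL2K ℂ c₀ ((η : ℂ))⁻¹ (adTransportW φ U₁) w‖ ≤ Real.sqrt (RCLike.re ⟪w, laplacePrimeA L m φ η U₁ a' (c₁ := c₁) w⟫_ℂ) := by
  rw [B9Thm311DeltaPrimeA.re_inner_laplacePrimeA L m φ η U₁ a' hRS₁ w]
  calc ‖covDerivL2K ℂ c₀ ((η : ℂ))⁻¹ (adTransportW φ U₁) w‖ = Real.sqrt (‖covDerivL2K ℂ c₀ ((η : ℂ))⁻¹ (adTransportW φ U₁) w‖ ^ 2) :=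
        (Real.sqrt_sq (norm_nonneg _)).symm
    _ ≤ _ := Real.sqrt_le_sqrt (le_add_of_nonneg_right (mul_nonneg ha' (sq_nonneg _)))

variable (hpos₁ : ∀ x : SiteL2K ℂ d (fineP L m) c₀ W, x ≠ 0 → 0 < RCLike.re ⟪x, laplacePrimeA L m φ η U₁ a' (c₁ := c₁) x⟫_ℂ)
  (hpos₂ : ∀ x : SiteL2K ℂ d (fineP L m) c₀ W, x ≠ 0 → 0 < RCLike.re ⟪x, laplacePrimeA L m φ η U₂ a' (c₁ := c₁) x⟫_ℂ)
  {γ δD M₁ M₂ θQ : ℝ} (hγ : 0 < γ) (hδD : 0 ≤ δD) (hM₁ : 0 ≤ M₁) (hM₂ : 0 ≤ M₂) (hθQ : 0 ≤ θQ)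
  (hc₁ : ∀ x, γ * ‖x‖ ^ 2 ≤ RCLike.re ⟪x, laplacePrimeA L m φ η U₁ a' (c₀ := c₀) (c₁ := c₁) x⟫_ℂ)
  (hc₂ : ∀ x, γ * ‖x‖ ^ 2 ≤ RCLike.re ⟪x, laplacePrimeA L m φ η U₂ a' (c₀ := c₀) (c₁ := c₁) x⟫_ℂ)
  (hD : ∀ x : SiteL2K ℂ d (fineP L m) c₀ W,
    ‖covDerivL2K ℂ c₀ ((η : ℂ))⁻¹ (adTransportW φ U₂) x - covDerivL2K ℂ c₀ ((η : ℂ))⁻¹ (adTransportW φ U₁) x‖ ≤ δD * ‖x‖)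
  (hQ₁ : ∀ x, ‖((WL2.linearEquiv ℂ ℂ (fun _ : TSite d m => c₁)).symm.toLinearMap ∘ₗ QprimeW L m φ U₁ (c₀ := c₀)) x‖ ≤ M₁ * ‖x‖)
  (hQ₂ : ∀ x, ‖((WL2.linearEquiv ℂ ℂ (fun _ : TSite d m => c₁)).symm.toLinearMap ∘ₗ QprimeW L m φ U₂ (c₀ := c₀)) x‖ ≤ M₂ * ‖x‖)
  (hdQ : ∀ x, ‖((WL2.linearEquiv ℂ ℂ (fun _ : TSite d m => c₁)).symm.toLinearMap ∘ₗ QprimeW L m φ U₂ (c₀ := c₀)) x -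
    ((WL2.linearEquiv ℂ ℂ (fun _ : TSite d m => c₁)).symm.toLinearMap ∘ₗ QprimeW L m φ U₁ (c₀ := c₀)) x‖ ≤ θQ * ‖x‖)

include hRS₁ hRS₂ ha' hγ hδD hM₁ hM₂ hθQ hc₁ hc₂ hD hQ₁ hQ₂ hdQ in
/-- **`‖G′(U₁)y − G′(U₂)y‖ ≤ (2δ_D·γ⁻¹(√γ)⁻¹ + |a′|·θ_Q(M₁ + M₂)·γ⁻²)·‖y‖` — THE `θ_G` LETTER OF `B9Eq325RLipschitzResolvent.norm_RofU_sub_RofU_le` PRODUCED (same order `U₁ − U₂` as its `hdG` slot)**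
from the DISPLAYED coercivity `γ` of both `Δ′_a(U_i)` (NE9 leaf-03's S3b, form-relative), the `D`-difference `δ_D` (`B9Eq373DerivativeRemainderL2.norm_covDerivL2K_sub_le`:
`√d‖η⁻¹‖εR`, η-free at `εR = K_Rαη`) and the `Q̃′`-letters `M_i`, `θ_Q` (`B9Eq325RLipschitzResolvent` §4, `(ηL)⁻¹`-sized): §1 at `T_i := Δ′_a(U_i)` with the
form difference split as `⟪(D₁−D₂)z, D₁w⟫ + ⟪D₂z, (D₁−D₂)w⟫ + a′[⟪(Q̃′₁−Q̃′₂)z, Q̃′₁w⟫ + ⟪Q̃′₂z, (Q̃′₁−Q̃′₂)w⟫]`.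
[cite: Balaban1985BackgroundPropagators, (3.63)–(3.64) p.402, (3.24)–(3.25) p.394] -/
theorem norm_GpOfU_sub_GpOfU_le (y : SiteL2K ℂ d (fineP L m) c₀ W) :
    ‖GpOfU L m φ η U₁ a' (c₁ := c₁) hpos₁ y - GpOfU L m φ η U₂ a' (c₁ := c₁) hpos₂ y‖ ≤
      (2 * δD * (γ⁻¹ * (Real.sqrt γ)⁻¹) + (|a'| * θQ * (M₁ + M₂)) * γ⁻¹ ^ 2) * ‖y‖ := by
  rw [norm_sub_rev]
  -- abbreviations
  set D₁ := covDerivL2K ℂ c₀ ((η : ℂ))⁻¹ (adTransportW φ U₁) with hD₁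
  set D₂ := covDerivL2K ℂ c₀ ((η : ℂ))⁻¹ (adTransportW φ U₂) with hD₂
  set P₁ := (WL2.linearEquiv ℂ ℂ (fun _ : TSite d m => c₁)).symm.toLinearMap ∘ₗ QprimeW L m φ U₁ (c₀ := c₀) with hP₁
  set P₂ := (WL2.linearEquiv ℂ ℂ (fun _ : TSite d m => c₁)).symm.toLinearMap ∘ₗ QprimeW L m φ U₂ (c₀ := c₀) with hP₂
  have hform : ∀ z w : SiteL2K ℂ d (fineP L m) c₀ W,
      ‖⟪z, laplacePrimeA L m φ η U₁ a' (c₁ := c₁) w⟫_ℂ - ⟪z, laplacePrimeA L m φ η U₂ a' (c₁ := c₁) w⟫_ℂ‖ ≤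
        δD * (‖z‖ * Real.sqrt (RCLike.re ⟪w, laplacePrimeA L m φ η U₁ a' (c₁ := c₁) w⟫_ℂ) +
          Real.sqrt (RCLike.re ⟪z, laplacePrimeA L m φ η U₂ a' (c₁ := c₁) z⟫_ℂ) * ‖w‖) + |a'| * θQ * (M₁ + M₂) * (‖z‖ * ‖w‖) := by
    intro z w
    rw [inner_laplacePrimeA_eq L m φ c₀ η U₁ c₁ a' hRS₁ z w, inner_laplacePrimeA_eq L m φ c₀ η U₂ c₁ a' hRS₂ z w]
    -- the split
    have hsplit : ⟪D₁ z, D₁ w⟫_ℂ + (a' : ℂ) * ⟪P₁ z, P₁ w⟫_ℂ - (⟪D₂ z, D₂ w⟫_ℂ + (a' : ℂ) * ⟪P₂ z, P₂ w⟫_ℂ) =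
        (⟪D₁ z - D₂ z, D₁ w⟫_ℂ + ⟪D₂ z, D₁ w - D₂ w⟫_ℂ) + (a' : ℂ) * (⟪P₁ z - P₂ z, P₁ w⟫_ℂ + ⟪P₂ z, P₁ w - P₂ w⟫_ℂ) := by
      simp only [inner_sub_left, inner_sub_right]; ring
    have hDzw : ‖D₁ z - D₂ z‖ ≤ δD * ‖z‖ := by rw [← norm_neg, neg_sub]; exact hD z
    have hDw : ‖D₁ w - D₂ w‖ ≤ δD * ‖w‖ := by rw [← norm_neg, neg_sub]; exact hD w
    have hPz : ‖P₁ z - P₂ z‖ ≤ θQ * ‖z‖ := by rw [← norm_neg, neg_sub]; exact hdQ z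
    have hPw : ‖P₁ w - P₂ w‖ ≤ θQ * ‖w‖ := by rw [← norm_neg, neg_sub]; exact hdQ w
    have hE₁ : ‖D₁ w‖ ≤ Real.sqrt (RCLike.re ⟪w, laplacePrimeA L m φ η U₁ a' (c₁ := c₁) w⟫_ℂ) :=
      norm_covDerivL2K_le_sqrt_re_inner L m φ c₀ η U₁ c₁ a' ha' hRS₁ w
    have hE₂ : ‖D₂ z‖ ≤ Real.sqrt (RCLike.re ⟪z, laplacePrimeA L m φ η U₂ a' (c₁ := c₁) z⟫_ℂ) :=
      norm_covDerivL2K_le_sqrt_re_inner L m φ c₀ η U₂ c₁ a' ha' hRS₂ z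
    show ‖⟪D₁ z, D₁ w⟫_ℂ + (a' : ℂ) * ⟪P₁ z, P₁ w⟫_ℂ - (⟪D₂ z, D₂ w⟫_ℂ + (a' : ℂ) * ⟪P₂ z, P₂ w⟫_ℂ)‖ ≤ _
    rw [hsplit]
    calc _ ≤ ‖⟪D₁ z - D₂ z, D₁ w⟫_ℂ + ⟪D₂ z, D₁ w - D₂ w⟫_ℂ‖ + ‖(a' : ℂ) * (⟪P₁ z - P₂ z, P₁ w⟫_ℂ + ⟪P₂ z, P₁ w - P₂ w⟫_ℂ)‖ := norm_add_le _ _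
      _ ≤ (‖D₁ z - D₂ z‖ * ‖D₁ w‖ + ‖D₂ z‖ * ‖D₁ w - D₂ w‖) + |a'| * (‖P₁ z - P₂ z‖ * ‖P₁ w‖ + ‖P₂ z‖ * ‖P₁ w - P₂ w‖) := by
          refine add_le_add ((norm_add_le _ _).trans (add_le_add (norm_inner_le_norm _ _) (norm_inner_le_norm _ _))) ?_
          rw [norm_mul, Complex.norm_real, Real.norm_eq_abs]
          exact mul_le_mul_of_nonneg_left ((norm_add_le _ _).trans (add_le_add (norm_inner_le_norm _ _) (norm_inner_le_norm _ _))) (abs_nonneg _)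
      _ ≤ (δD * ‖z‖ * Real.sqrt (RCLike.re ⟪w, laplacePrimeA L m φ η U₁ a' (c₁ := c₁) w⟫_ℂ) +
            Real.sqrt (RCLike.re ⟪z, laplacePrimeA L m φ η U₂ a' (c₁ := c₁) z⟫_ℂ) * (δD * ‖w‖)) +
          |a'| * (θQ * ‖z‖ * (M₁ * ‖w‖) + M₂ * ‖z‖ * (θQ * ‖w‖)) := by
          gcongr
          · exact hQ₁ w
          · exact hQ₂ z
      _ = _ := by ring
  have h := norm_greenK_sub_greenK_le_of_form (𝕜 := ℂ) hγ hpos₁ hpos₂ hc₁ hc₂ (laplacePrimeA_isSymmetric L m φ c₀ η U₂ c₁ a' hRS₂) hδD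
    (by positivity : 0 ≤ |a'| * θQ * (M₁ + M₂)) hform y
  unfold GpOfU
  exact h

end Chain

end Literature.MathematicalPhysics.QuantumFieldTheory.Balaban1983to89.B9Eq364GreenLipschitzForm

end
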